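import Summits.ResolutionOfSingularities.ResolutionOfSingularities.Theorems.EquisingularLiftEquisingularLiftNatSNCStepCharts
import Summits.ResolutionOfSingularities.ResolutionOfSingularities.Theorems.EquisingularLiftEquisingularLiftNatNDSNCInv2
import Literature.AlgebraicGeometry.Resolution.StrictTransformDistinct
import HarnessLib

/-!
# (B3b) `sncInv_stepFacts` — the SNC invariant `ND.SNCInv₂` SURVIVES ONE STRATA STEP: `StepFacts O k θ P q Ch (ND.SNCInv₂ P Y)`

[OURS · L1 W4.5b · EL♮(3) stmt-ResolutionOfSingularities-20148 · desk R31 (β) DEAL «ND-K5» brick (B3b) · res-L1-w45b-stub-2 g14] — NOT a statement of the manuscript [Hironaka2017]; counted 0; AI kernel work weaker than expert review.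
Closes BY NAME (statement = the type of idea-1's SPEC v8 §13.7 `sncInv_stepFacts`, `Cruxes/EquisingularLiftNatThree/NewtonNondegenerateRungK5.lean`
8ef2f24fa1342945 l.212, with the `hθ` binder S-T36) the (B3b) clause of the O-side brick (B3) `hsub_strataLift` of the ND-K5 engine word: (B3) is
DERIVED from (B3a) `sncInv_init` (res-type-027) / (B3g) `sncInv_stratumFacts` (res-L1-w45b-stub-4) / (B3b) through the PROVED iteration
`ND.hsub_strataLift_of_invariant` (p639684) over `ND.strataTower_lift` (p638808). The invariant is `ND.SNCInv₂` (`…NatNDSNCInv2`, the desk's merged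
re-cut of 2026-08-28T14:06Z: 027's U-free pointwise `SNCWithAt` form + this seat's (A1) `IsClosedImmersion jm` and (A2) pointwise fibre-vs-member
guard — the v4 global guard is NOT step-stable, witness STATUS 14:04Z).

THE STEP. Given `SNCInv₂ X σ F jm EX E` with present rays `R`, a face `τ` with a non-frame ray `ρ₀`, the blow-ups `τX` of `C = stratum EX τ`
and `υ` of `stratum E τ`, and the new model square `j' ≫ τX = υ ≫ jm` (a pull-back of `Spec k → Spec O`), the new stage carries `SNCInv₂` with
`R₂ := insert (Σ_{ρ∈τ} ρ) R`:
* (A1) `j'` is the base change of `jm` along `τX` (`isPullback_of_model_step`), a closed immersion with `ker j' = (ker jm)·𝒪_{X₂}`;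
* (a) absent rays stay `⊤` (`stepAlong_eq_top`); (b) the new members lie over old non-frame members (`mem_support_of_mem_support_strictTransformIdeal`);
* every point `y'` of the NEW non-frame exceptional support maps to a point of the OLD one (the exceptional divisor lies over `V(C) ⊆ V(EX ρ₀)`,
  strict transforms over their divisors), where (c)/(c′) hold; at such a point over the centre, `L = ker jm :: members` has snc WITH `C`
  (`sncWithAt_finsetSup_of_sncWithAt`: `C` is a stratum of members, all present) and the fibre is transversal to `C`
  (`not_stalkIdeal_le_finsetSup_of_forall_ne` from (c′));
* (c) `IsBlowup.sncWithAt_transform` gives snc at `y'` of «`St(ker jm)` :: strict transforms :: exceptional»; the head is replaced by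
  `ker j' = (ker jm)·𝒪_{X₂}` (same germ: `stalkIdeal_strictTransformIdeal_eq_comap_of_transversal`; `SNCWithAt.replace_head_of_stalk_ne` with the
  new (c′)) and the new list `ker j' :: (EX₂ ρ)_{ρ ∈ R₂}` is a sub-family (`SNCWithAt.anti`);
* (c′) `stalkIdeal_exceptional_ne_comap` / `stalkIdeal_strictTransformIdeal_ne_comap`;
* (d) exceptional ray: `(C·𝒪_{X₂})·𝒪_{F₂} = (C·𝒪_F)·𝒪_{F₂}` and `C·𝒪_F = stratum E τ` STALKWISE (`comap_stratum_eq_of_clauses`: non-frame rays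
  exactly, frame rays on the downstairs exceptional support, both sides `⊤` off it); strict transforms: `comap_strictTransformIdeal_le` and the
  stalkwise saturation `stalkIdeal_comap_strictTransformIdeal_eq_of_sncWithAt` — globally for non-frame rays (their points all lie over the
  exceptional support or off `V(St K)`), at the points of the new downstairs exceptional support for frame rays, finishing with the stalk formula
  `stalkIdeal_strictTransformIdeal` downstairs and (d)-old at `υ y`.
Unused hypotheses of `StepFacts` (the invariant carries what is needed): E1-legality, `IsIntegral`/`IsRegular X₂`, `IsBlowup υ`, `IsIntegral F₂`, `hθ`.

[cite: Kollar2007, Def. 3.25] [cite: GortzWedhorn2020, Prop. 13.91 and (13.19)] [cite: Matsumura1987, Thm. 14.2, Thm. 14.3]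
[cite: BierstoneGrigorievMilmanWlodarczyk2011, Def. 3.1.1, Def. 3.1.3 (4)]
-/

set_option linter.dupNamespace false -- mandated namespace `Summit.<Summit>.<Problem>` of this single-conjunct summit

noncomputable section

open CategoryTheory CategoryTheory.Limits AlgebraicGeometry TopologicalSpace Topology IsLocalRing
open Literature.AlgebraicGeometry.Resolution
open AlgebraicGeometry.Scheme.IdealSheafData
open Summit.ResolutionOfSingularities.ResolutionOfSingularities.Theorems.DepthSNC

namespace Summit.ResolutionOfSingularities.ResolutionOfSingularities.Cruxes.EquisingularLiftNat.Sections.ND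

open Summit.ResolutionOfSingularities.ResolutionOfSingularities.Cruxes.EquisingularLiftNat.Sections

/-! ## The stratum pulls back to the downstairs stratum -/

/-- Comap of a stratum along the model is the downstairs stratum, given clause (a) and the model-compatibility clause (d). [OURS] -/
theorem comap_stratum_eq_of_clauses {n : ℕ} {X F : Scheme.{0}} (jm : F ⟶ X) (EX : Boundary n X) (E : Boundary n F)
    (R : Finset (Ray n)) (ha : ∀ ρ, ρ ∉ R → EX ρ = ⊤ ∧ E ρ = ⊤)
    (hd1 : ∀ ρ ∈ R, ρ ∉ Set.range (e n) → (EX ρ).comap jm = E ρ)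
    (hd2 : ∀ (i : Fin n) (y : F), (∃ ρ ∈ R, ρ ∉ Set.range (e n) ∧ y ∈ ((E ρ).support : Set F)) →
      stalkIdeal ((EX (e n i)).comap jm) y = stalkIdeal (E (e n i)) y)
    (τ : Finset (Ray n)) {ρ₀ : Ray n} (hρ₀ : ρ₀ ∈ τ) (hρ₀nf : ρ₀ ∉ Set.range (e n)) :
    (stratum EX τ).comap jm = stratum E τ := by
  classical
  unfold stratum
  rw [comap_finsetSup_fun]
  by_cases hρ₀R : ρ₀ ∈ R
  swap
  · -- the face carries an absent ray: both strata are `⊤`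
    rw [finsetSup_eq_top_of_mem hρ₀ (show (EX ρ₀).comap jm = ⊤ by rw [(ha ρ₀ hρ₀R).1, Scheme.IdealSheafData.comap_top]),
      finsetSup_eq_top_of_mem hρ₀ (ha ρ₀ hρ₀R).2]
  have key : ∀ y : F, stalkIdeal (τ.sup fun ρ => (EX ρ).comap jm) y = stalkIdeal (τ.sup E) y := by
    intro y
    rw [stalkIdeal_finsetSup_fun, stalkIdeal_finsetSup_fun]
    by_cases hy : y ∈ ((E ρ₀).support : Set F)
    · -- on the downstairs exceptional support every term matches
      refine Finset.sup_congr rfl fun ρ _ => ?_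
      by_cases hρR : ρ ∈ R
      · by_cases hρf : ρ ∈ Set.range (e n)
        · obtain ⟨i, rfl⟩ := hρf
          exact hd2 i y ⟨ρ₀, hρ₀R, hρ₀nf, hy⟩
        · rw [hd1 ρ hρR hρf]
      · rw [(ha ρ hρR).1, (ha ρ hρR).2, Scheme.IdealSheafData.comap_top]
    · -- off it, the `ρ₀`-term is `⊤` on both sides
      have h1 : stalkIdeal (E ρ₀) y = ⊤ := stalkIdeal_eq_top_of_not_mem_support hy
      have h2 : stalkIdeal ((EX ρ₀).comap jm) y = ⊤ := by rw [hd1 ρ₀ hρ₀R hρ₀nf, h1]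
      rw [finsetSup_eq_top_of_mem (f := fun ρ => stalkIdeal ((EX ρ).comap jm) y) hρ₀ h2,
        finsetSup_eq_top_of_mem (f := fun ρ => stalkIdeal (E ρ) y) hρ₀ h1]
  exact le_antisymm (le_of_forall_stalkIdeal_le fun y => (key y).le) (le_of_forall_stalkIdeal_le fun y => (key y).ge)


/-- **(B3b) `sncInv_stepFacts` — the SNC invariant `SNCInv₂` survives one strata step.** [OURS · L1 W4.5b · EL♮(3) (B3b)] -/
theorem sncInv_stepFacts (O : Type) [CommRing O] [IsDomain O] [IsDiscreteValuationRing O] (k : Type) [Field k] (θ : O →+* k)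
    (_hθ : Function.Surjective θ) (P : Scheme.{0}) (q : P ⟶ Spec (.of O)) (Y : Set P)
    (Ch : ∀ X' : Scheme.{0}, (X' ⟶ P) → Set X' → Prop) (n : ℕ) :
    StepFacts (n := n) O k θ P q Ch (SNCInv₂ (n := n) P Y) := by
  classical
  intro X σ S F jm t T EX E hst hG τ hτ _hE1 _hT X₂ τX hτX _hX₂i hX₂n _hX₂r F₂ υ _hυ _hF₂i j' t' hsq' hcomm
  obtain ⟨-, -, hXn, -, -, -, hsq, -, -, -⟩ := hst
  obtain ⟨hjm, R, ha, hb, hc, hc', hd1, hd2⟩ := hG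
  obtain ⟨ρ₀, hρ₀τ, hρ₀nf⟩ := hτ
  haveI := hjm
  haveI := hXn
  haveI := hX₂n
  -- the new model square
  have hsq'' : IsPullback j' t' (τX ≫ σ ≫ q) (Spec.map (CommRingCat.ofHom θ)) := by
    simpa only [Category.assoc] using hsq'
  have hpb : IsPullback j' υ τX jm := isPullback_of_model_step hsq hsq'' hcomm
  haveI hj'ci : IsClosedImmersion j' := isClosedImmersion_of_model_step hpb
  haveI : IsLocallyNoetherian F₂ := by
    have hft := ((IsFinite.iff_isIntegralHom_and_locallyOfFiniteType _).mp
      ((IsClosedImmersion.iff_isFinite_and_mono _).mp hj'ci).1).2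
    exact @LocallyOfFiniteType.isLocallyNoetherian _ _ j' hft hX₂n
  have hkerj' : j'.ker = jm.ker.comap τX := ker_eq_comap_ker_of_model_step hpb
  set ν : Ray n := ∑ ρ ∈ τ, ρ with hν
  -- the list and its members
  have hΦL : jm.ker ∈ (jm.ker :: (R.toList.map fun ρ => EX ρ)) := List.mem_cons_self
  have hmemL : ∀ ρ ∈ R, EX ρ ∈ (jm.ker :: (R.toList.map fun ρ => EX ρ)) := fun ρ hρ =>
    List.mem_cons_of_mem _ (List.mem_map.mpr ⟨ρ, Finset.mem_toList.mpr hρ, rfl⟩)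
  -- the centre lies inside `V(EX ρ₀)`; where it is non-empty, `ρ₀` and all rays of `τ` are present
  have hsuppC : ∀ x : X, x ∈ (stratum EX τ).support → x ∈ (EX ρ₀).support := fun x hx =>
    Scheme.IdealSheafData.support_antitone (Finset.le_sup (f := EX) hρ₀τ) hx
  have hmemR_of : ∀ x : X, x ∈ (stratum EX τ).support → ∀ ρ ∈ τ, ρ ∈ R := by
    intro x hx ρ hρτ
    by_contra hρR
    have htop : stratum EX τ = ⊤ := finsetSup_eq_top_of_mem hρτ (ha ρ hρR).1
    rw [htop, Scheme.IdealSheafData.support_top] at hx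
    exact hx
  have hSig_of_C : ∀ x : X, x ∈ (stratum EX τ).support → ∃ ρ ∈ R, ρ ∉ Set.range (e n) ∧ x ∈ ((EX ρ).support : Set X) :=
    fun x hx => ⟨ρ₀, hmemR_of x hx ρ₀ hρ₀τ, hρ₀nf, hsuppC x hx⟩
  have hstratum : (τ.image EX).sup id = stratum EX τ := by
    unfold stratum; rw [Finset.sup_image]; rfl
  -- pointwise snc WITH the centre, and transversality of the fibre, at the points of the centre
  have hLC : ∀ x : X, x ∈ (stratum EX τ).support →
      SNCWithAt (jm.ker :: (R.toList.map fun ρ => EX ρ)) (stratum EX τ) x := by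
    intro x hx
    rw [← hstratum]
    refine sncWithAt_finsetSup_of_sncWithAt (hc x (hSig_of_C x hx)) (τ.image EX) fun D hD => ?_
    obtain ⟨ρ, hρτ, rfl⟩ := Finset.mem_image.mp hD
    exact hmemL ρ (hmemR_of x hx ρ hρτ)
  have hΦC : ∀ x : X, x ∈ (stratum EX τ).support → x ∈ jm.ker.support →
      ¬ stalkIdeal jm.ker x ≤ stalkIdeal (stratum EX τ) x := by
    intro x hx hxΦ
    rw [← hstratum]
    refine not_stalkIdeal_le_finsetSup_of_forall_ne (hc x (hSig_of_C x hx)) hΦL (τ.image EX) (fun D hD => ?_)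
      (fun D hD hxD => ?_) (by rw [hstratum]; exact hx) hxΦ
    · obtain ⟨ρ, hρτ, rfl⟩ := Finset.mem_image.mp hD
      exact hmemL ρ (hmemR_of x hx ρ hρτ)
    · obtain ⟨ρ, hρτ, rfl⟩ := Finset.mem_image.mp hD
      exact hc' ρ (hmemR_of x hx ρ hρτ) x (hSig_of_C x hx) hxΦ hxD
  -- the stratum pulls back to the downstairs stratum
  have hCD : (stratum EX τ).comap jm = stratum E τ := comap_stratum_eq_of_clauses jm EX E R ha hd1 hd2 τ hρ₀τ hρ₀nf
  have hexcD : ((stratum EX τ).comap τX).comap j' = (stratum E τ).comap υ := by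
    rw [← Scheme.IdealSheafData.comap_comp, hcomm, Scheme.IdealSheafData.comap_comp, hCD]
  -- the new non-frame exceptional support maps into the old one
  have hSig₂ : ∀ (y' : X₂) (ρ : Ray n), ρ ∈ insert ν R → ρ ∉ Set.range (e n) →
      y' ∈ ((EX.stepAlong (stratum EX τ) ν τX ρ).support : Set X₂) →
      ∃ ρ' ∈ R, ρ' ∉ Set.range (e n) ∧ τX y' ∈ ((EX ρ').support : Set X) := by
    intro y' ρ hρ hρnf hy'
    by_cases hρν : ρ = ν
    · rw [hρν, stepAlong_self] at hy'
      have h1 : τX y' ∈ (stratum EX τ).support := by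
        rw [Scheme.IdealSheafData.support_comap] at hy'; exact hy'
      exact hSig_of_C _ h1
    · have hρR : ρ ∈ R := (Finset.mem_insert.mp hρ).resolve_left hρν
      rw [stepAlong_of_ne _ _ hρν] at hy'
      exact ⟨ρ, hρR, hρnf, mem_support_of_mem_support_strictTransformIdeal hy'⟩
  -- (d1) for the new stage, proved first (used by (d2))
  have hd1new : ∀ ρ ∈ insert ν R, ρ ∉ Set.range (e n) →
      (EX.stepAlong (stratum EX τ) ν τX ρ).comap j' = E.stepAlong (stratum E τ) ν υ ρ := by
    intro ρ hρ hρnf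
    by_cases hρν : ρ = ν
    · rw [hρν, stepAlong_self, stepAlong_self, hexcD]
    · have hρR : ρ ∈ R := (Finset.mem_insert.mp hρ).resolve_left hρν
      rw [stepAlong_of_ne _ _ hρν, stepAlong_of_ne _ _ hρν, ← hCD, ← hd1 ρ hρR hρnf]
      refine le_antisymm (comap_strictTransformIdeal_le jm hcomm _ _) (le_of_forall_stalkIdeal_le fun y => le_of_eq ?_)
      exact (stalkIdeal_comap_strictTransformIdeal_eq_of_sncWithAt hτX hpb hΦL (hmemL ρ hρR) y
        (fun h => hLC _ h) (fun h h' => hΦC _ h h')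
        (fun h1 h2 => hc' ρ hρR _ ⟨ρ, hρR, hρnf, h2⟩ h1 h2)).symm
  refine ⟨hj'ci, insert ν R, ?_, ?_, ?_, ?_, hd1new, ?_⟩
  · -- (a) absent rays
    intro ρ hρ
    have hρν : ρ ≠ ν := fun h => hρ (h ▸ Finset.mem_insert_self _ _)
    have hρR : ρ ∉ R := fun h => hρ (Finset.mem_insert_of_mem h)
    exact ⟨stepAlong_eq_top EX _ hρν τX (ha ρ hρR).1, stepAlong_eq_top E _ hρν υ (ha ρ hρR).2⟩
  · -- (b) off the generic point of `Y`
    intro ρ hρ hρnf z hz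
    obtain ⟨y', hy', rfl⟩ := hz
    obtain ⟨ρ', hρ'R, hρ'nf, hτy⟩ : ∃ ρ' ∈ R, ρ' ∉ Set.range (e n) ∧ τX y' ∈ ((EX ρ').support : Set X) := by
      by_cases hρν : ρ = ν
      · exact hSig₂ y' ρ hρ hρnf hy'
      · have hρR : ρ ∈ R := (Finset.mem_insert.mp hρ).resolve_left hρν
        rw [stepAlong_of_ne _ _ hρν] at hy'
        exact ⟨ρ, hρR, hρnf, mem_support_of_mem_support_strictTransformIdeal hy'⟩
    exact hb ρ' hρ'R hρ'nf ⟨τX y', hτy, (Scheme.Hom.comp_apply τX σ y').symm⟩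
  · -- (c) snc at the points of the new non-frame exceptional support
    rintro y' ⟨ρ, hρ, hρnf, hy'⟩
    obtain ⟨ρ', hρ'R, hρ'nf, hSigx⟩ := hSig₂ y' ρ hρ hρnf hy'
    have hold : SNCWithAt (jm.ker :: (R.toList.map fun ρ => EX ρ)) ⊤ (τX y') := hc _ ⟨ρ', hρ'R, hρ'nf, hSigx⟩
    have hLCx : SNCWithAt (jm.ker :: (R.toList.map fun ρ => EX ρ)) (stratum EX τ) (τX y') := by
      by_cases hxC : τX y' ∈ (stratum EX τ).support
      · exact hLC _ hxC
      · exact hold.of_not_mem_support hxC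
    have htrans : SNCWithAt (strictTransformIdeal τX (stratum EX τ) jm.ker ::
        ((R.toList.map fun ρ => EX ρ).map (strictTransformIdeal τX (stratum EX τ)) ++ [(stratum EX τ).comap τX])) ⊤ y' :=
      hτX.sncWithAt_transform y' hLCx
    -- replace the head `St jm.ker` by `j'.ker`
    have hst : stalkIdeal j'.ker y' = stalkIdeal (strictTransformIdeal τX (stratum EX τ) jm.ker) y' := by
      rw [hkerj']
      exact (stalkIdeal_strictTransformIdeal_eq_comap_of_transversal hτX hΦL y' (fun h => hLC _ h) (fun h h' => hΦC _ h h')).symm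
    have hnew := SNCWithAt.replace_head_of_stalk_ne htrans hst (fun D hD hyD hyΦ => ?_)
    · refine hnew.anti fun D hD hyD => ?_
      rcases List.mem_cons.mp hD with rfl | hD
      · exact List.mem_cons_self
      · refine List.mem_cons_of_mem _ (List.mem_append.mpr ?_)
        obtain ⟨ρ₁, hρ₁, rfl⟩ := List.mem_map.mp hD
        have hρ₁' : ρ₁ ∈ insert ν R := Finset.mem_toList.mp hρ₁
        by_cases hρ₁ν : ρ₁ = ν
        · right; rw [hρ₁ν, stepAlong_self]; exact List.mem_singleton.mpr rfl
        · left
          have hρ₁R : ρ₁ ∈ R := (Finset.mem_insert.mp hρ₁').resolve_left hρ₁ν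
          rw [stepAlong_of_ne _ _ hρ₁ν]
          exact List.mem_map.mpr ⟨EX ρ₁, List.mem_map.mpr ⟨ρ₁, Finset.mem_toList.mpr hρ₁R, rfl⟩, rfl⟩
    · -- the tail members' germs differ from the fibre's germ at `y'`
      rw [hkerj'] at hyΦ ⊢
      rcases List.mem_append.mp hD with hD | hD
      · obtain ⟨K, hK, rfl⟩ := List.mem_map.mp hD
        obtain ⟨ρ₁, hρ₁, rfl⟩ := List.mem_map.mp hK
        have hρ₁R : ρ₁ ∈ R := Finset.mem_toList.mp hρ₁
        exact stalkIdeal_strictTransformIdeal_ne_comap hτX hΦL y' (fun h => hLC _ h) (fun h h' => hΦC _ h h') (hmemL ρ₁ hρ₁R)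
          (fun h1 h2 => hc' ρ₁ hρ₁R _ ⟨ρ', hρ'R, hρ'nf, hSigx⟩ h1 h2) hyΦ hyD
      · rw [List.mem_singleton.mp hD] at hyD ⊢
        exact stalkIdeal_exceptional_ne_comap hτX hΦL y' (fun h => hLC _ h) (fun h h' => hΦC _ h h') hyΦ hyD
  · -- (c′) the fibre's germ differs from every present member's germ there
    rintro ρ hρ y' ⟨ρ₂, hρ₂, hρ₂nf, hy'₂⟩ hyΦ hyρ
    obtain ⟨ρ', hρ'R, hρ'nf, hSigx⟩ := hSig₂ y' ρ₂ hρ₂ hρ₂nf hy'₂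
    rw [hkerj'] at hyΦ ⊢
    by_cases hρν : ρ = ν
    · rw [hρν, stepAlong_self] at hyρ ⊢
      exact stalkIdeal_exceptional_ne_comap hτX hΦL y' (fun h => hLC _ h) (fun h h' => hΦC _ h h') hyΦ hyρ
    · have hρR : ρ ∈ R := (Finset.mem_insert.mp hρ).resolve_left hρν
      rw [stepAlong_of_ne _ _ hρν] at hyρ ⊢
      exact stalkIdeal_strictTransformIdeal_ne_comap hτX hΦL y' (fun h => hLC _ h) (fun h h' => hΦC _ h h') (hmemL ρ hρR)
        (fun h1 h2 => hc' ρ hρR _ ⟨ρ', hρ'R, hρ'nf, hSigx⟩ h1 h2) hyΦ hyρ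
  · -- (d2) frame rays, stalkwise on the new downstairs exceptional support
    rintro i y ⟨ρ, hρ, hρnf, hy⟩
    -- the point lies over the old exceptional supports, upstairs and downstairs
    have hy' : j' y ∈ ((EX.stepAlong (stratum EX τ) ν τX ρ).support : Set X₂) := by
      rw [← hd1new ρ hρ hρnf, Scheme.IdealSheafData.support_comap] at hy; exact hy
    obtain ⟨ρ', hρ'R, hρ'nf, hSigx⟩ := hSig₂ (j' y) ρ hρ hρnf hy'
    have hjυ : jm (υ y) = τX (j' y) := by
      rw [← Scheme.Hom.comp_apply, ← hcomm, Scheme.Hom.comp_apply]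
    have hexc₀ : ∃ ρ' ∈ R, ρ' ∉ Set.range (e n) ∧ υ y ∈ ((E ρ').support : Set F) := by
      refine ⟨ρ', hρ'R, hρ'nf, ?_⟩
      rw [← hd1 ρ' hρ'R hρ'nf, Scheme.IdealSheafData.support_comap]
      change jm (υ y) ∈ ((EX ρ').support : Set X)
      rw [hjυ]; exact hSigx
    by_cases hiν : e n i = ν
    · rw [hiν, stepAlong_self, stepAlong_self, hexcD]
    · rw [stepAlong_of_ne _ _ hiν, stepAlong_of_ne _ _ hiν]
      by_cases hiR : e n i ∈ R
      swap
      · rw [(ha _ hiR).1, (ha _ hiR).2, strictTransformIdeal_top, strictTransformIdeal_top, Scheme.IdealSheafData.comap_top]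
      calc stalkIdeal ((strictTransformIdeal τX (stratum EX τ) (EX (e n i))).comap j') y
          = stalkIdeal (strictTransformIdeal υ ((stratum EX τ).comap jm) ((EX (e n i)).comap jm)) y :=
            stalkIdeal_comap_strictTransformIdeal_eq_of_sncWithAt hτX hpb hΦL (hmemL _ hiR) y
              (fun h => hLC _ h) (fun h h' => hΦC _ h h') (fun h1 h2 => hc' (e n i) hiR _ ⟨ρ', hρ'R, hρ'nf, hSigx⟩ h1 h2)
        _ = stalkIdeal (strictTransformIdeal υ (stratum E τ) ((EX (e n i)).comap jm)) y := by rw [hCD]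
        _ = stalkIdeal (strictTransformIdeal υ (stratum E τ) (E (e n i))) y := by
            rw [stalkIdeal_strictTransformIdeal, stalkIdeal_strictTransformIdeal, hd2 i (υ y) hexc₀]


end Summit.ResolutionOfSingularities.ResolutionOfSingularities.Cruxes.EquisingularLiftNat.Sections.ND

end
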